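import Literature.NumberTheory.EllipticCurves.KatoRankBoundAllPrimesSkeletonProofs
import Literature.NumberTheory.EllipticCurves.Kato2004.ExceptionalPrimeInvolutionTransportProofs
import HarnessLib

/-!
# Height-one lengths of a module with an involution, away from `2`:
# `ℓ_𝔮(M) = ℓ_𝔮(M⁺) + ℓ_𝔮(M⁻)` — the `Δ = {±1}`-eigen-decomposition «up to modules killed by 2» read
# prime by prime, and the transfer of `ι`-symmetry from `M`, `M⁺` to `M⁻` (PROVED module theory)

For a commutative ring `R`, an `R`-module `M` and an `R`-linear involution `c` (`c ∘ c = id`), put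
`M⁺ = ker(c − 1)`, `M⁻ = ker(c + 1)`. The sum map `M⁺ × M⁻ → M` has kernel and cokernel killed by `2`
(`a + b = 0`, `c a = a`, `c b = −b` force `2a = 0`; `2m = (m + c m) + (m − c m)`), so at every prime `𝔮 ∌ 2`
(where such modules have local length `0`): **`ℓ_𝔮(M) = ℓ_𝔮(M⁺) + ℓ_𝔮(M⁻)`** (`Module.lengthAt_eq_add_of_involution`).
This is the classical «for `p` odd, `M = M⁺ ⊕ M⁻`» (Greenberg, LNM 1716 §1–§3 passim; Washington §13) in the
form valid at `p = 2` as well: equality of height-one LENGTHS away from `(2)`.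

Consequence (`Kato2004.lengthAt_minus_eq_comap_invol_of_total_of_plus`): over `Λ = ℤ_p⟦T⟧`, if `c` commutes with
the `Λ`-action and the lengths of `M` and of `M⁺` are symmetric under the Iwasawa involution `ι` at a pair of
height-one primes `𝔮, ι𝔮 ∌ 2` (finite lengths), then so are those of `M⁻`.

Motivation (cell `bsd-2adic`, seat `addL2x` GEN 16, crux stmt-BirchSwinnertonDyer-19098, T20 (a); record only):
`M = X(E'/ℚ(ζ_{2^∞}))` for the split-multiplicative twist `E'` of an additive curve `E = E' ⊗ ω`, `c` = the
non-trivial element of `Δ = Gal(ℚ(ζ_{2^∞})/ℚ_∞)`: `M⁺ ≐ X(E'/ℚ_∞)`, `M⁻ ≐ X(E/ℚ_∞)` (restriction along the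
quadratic layer; `E[2]` irreducible), Greenberg's Thm. 1.14 over `ℚ(i)` (for `M`) and over `ℚ` (for `M⁺`) then
give the `ι`-symmetry of the lengths of `X(E/ℚ_∞)` — the input `hX` of `Kato2004.lengthAt_H2_le_of_transport_exceptional`.
That identification is NOT made here. THEOREMS ONLY (no definition, no named fact, no instance, no `sorry`).

References: [GreenbergLNM1716] §1 (p. 60, `S^ι`), Thm. 1.14 (p. 68); [Washington1997] §13.2; [BourbakiAC5to7] VII §4.4.
-/

noncomputable section

open scoped Classical

namespace Literature.NumberTheory.EllipticCurves

namespace Module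

section Involution

variable {R : Type*} [CommRing R] {M : Type*} [AddCommGroup M] [_root_.Module R M]

/-- **`ℓ_𝔮(M) = ℓ_𝔮(ker(c − 1)) + ℓ_𝔮(ker(c + 1))` at every prime `𝔮 ∌ 2`, for an `R`-linear involution `c`
of `M`.** The sum map `ker(c−1) × ker(c+1) → M` has kernel and cokernel killed by `2`, hence of local length `0`
at `𝔮` (`lengthAt_eq_zero_of_smul_eq_zero`); lengths are additive (`lengthAt_eq_add_quotient`, `lengthAt_prod`).
[cite: GreenbergLNM1716, §1 (p. 60)] [cite: Washington1997, §13.2] -/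
theorem lengthAt_eq_add_of_involution (c : M →ₗ[R] M) (hc : ∀ m, c (c m) = m)
    (𝔮 : PrimeSpectrum R) (h2 : (2 : R) ∉ 𝔮.asIdeal) :
    lengthAt R M 𝔮 =
      lengthAt R (LinearMap.ker (c - LinearMap.id)) 𝔮 + lengthAt R (LinearMap.ker (c + LinearMap.id)) 𝔮 := by
  set Mp := LinearMap.ker (c - LinearMap.id) with hMp
  set Mm := LinearMap.ker (c + LinearMap.id) with hMm
  -- the sum map
  let s : (Mp × Mm) →ₗ[R] M := Mp.subtype.coprod Mm.subtype
  have hs : ∀ x : Mp × Mm, s x = (x.1 : M) + (x.2 : M) := fun x => by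
    simp [s, LinearMap.coprod_apply]
  have hmemp : ∀ {a : M}, a ∈ Mp ↔ c a = a := by
    intro a; rw [hMp, LinearMap.mem_ker, LinearMap.sub_apply, LinearMap.id_apply, sub_eq_zero]
  have hmemm : ∀ {b : M}, b ∈ Mm ↔ c b = -b := by
    intro b; rw [hMm, LinearMap.mem_ker, LinearMap.add_apply, LinearMap.id_apply, add_eq_zero_iff_eq_neg]
  -- kernel killed by 2
  have hker : ∀ x : LinearMap.ker s, (2 : R) • x = 0 := by
    rintro ⟨⟨a, b⟩, hx⟩
    rw [LinearMap.mem_ker, hs] at hx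
    have ha : c (a : M) = a := hmemp.mp a.2
    have hb : c (b : M) = -(b : M) := hmemm.mp b.2
    have hab : (a : M) = -(b : M) := eq_neg_of_add_eq_zero_left hx
    have h2a : (2 : R) • (a : M) = 0 := by
      have : (a : M) = -(a : M) := by
        calc (a : M) = c a := ha.symm
          _ = c (-(b : M)) := by rw [hab]
          _ = -(c (b : M)) := map_neg c _
          _ = (b : M) := by rw [hb, neg_neg]
          _ = -(a : M) := by rw [hab, neg_neg]
      rw [two_smul]
      nth_rewrite 2 [this]
      exact add_neg_cancel _
    have h2b : (2 : R) • (b : M) = 0 := by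
      have : (b : M) = -(a : M) := by rw [hab, neg_neg]
      rw [this, smul_neg, h2a, neg_zero]
    apply Subtype.ext
    apply Prod.ext
    · exact Subtype.ext (by simpa using h2a)
    · exact Subtype.ext (by simpa using h2b)
  -- cokernel killed by 2
  have hcoker : ∀ y : M ⧸ LinearMap.range s, (2 : R) • y = 0 := by
    intro y
    obtain ⟨m, rfl⟩ := Submodule.Quotient.mk_surjective _ y
    rw [← Submodule.Quotient.mk_smul, Submodule.Quotient.mk_eq_zero]
    have hp : m + c m ∈ Mp := by
      rw [hmemp, map_add, hc, add_comm]
    have hm : m - c m ∈ Mm := by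
      rw [hmemm, map_sub, hc, neg_sub]
    refine ⟨(⟨m + c m, hp⟩, ⟨m - c m, hm⟩), ?_⟩
    rw [hs]
    change (m + c m) + (m - c m) = (2 : R) • m
    rw [two_smul]; abel
  -- lengths
  have hL1 : lengthAt R (Mp × Mm) 𝔮 =
      lengthAt R (LinearMap.ker s) 𝔮 + lengthAt R ((Mp × Mm) ⧸ LinearMap.ker s) 𝔮 :=
    lengthAt_eq_add_quotient _ 𝔮
  have hL2 : lengthAt R M 𝔮 =
      lengthAt R (LinearMap.range s) 𝔮 + lengthAt R (M ⧸ LinearMap.range s) 𝔮 :=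
    lengthAt_eq_add_quotient _ 𝔮
  rw [lengthAt_eq_zero_of_smul_eq_zero (M := LinearMap.ker s) 𝔮 h2 hker, zero_add,
    lengthAt_eq_of_linearEquiv s.quotKerEquivRange 𝔮] at hL1
  rw [lengthAt_eq_zero_of_smul_eq_zero (M := M ⧸ LinearMap.range s) 𝔮 h2 hcoker, add_zero, ← hL1,
    lengthAt_prod] at hL2
  exact hL2

/-- **Transfer of a two-prime symmetry to the minus part.** If the lengths of `M` and of `M⁺ = ker(c−1)` agree
at two primes `𝔮, 𝔮' ∌ 2` and `M⁺` has finite length at `𝔮'`... more precisely both `ℓ_𝔮(M⁺)`, `ℓ_{𝔮'}(M⁺)` are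
finite, then the lengths of `M⁻ = ker(c+1)` agree at `𝔮, 𝔮'` too. Pure bookkeeping on the previous identity.
[cite: GreenbergLNM1716, Thm. 1.14 (p. 68)] -/
theorem lengthAt_minus_eq_of_total_of_plus (c : M →ₗ[R] M) (hc : ∀ m, c (c m) = m)
    (𝔮 𝔮' : PrimeSpectrum R) (h2 : (2 : R) ∉ 𝔮.asIdeal) (h2' : (2 : R) ∉ 𝔮'.asIdeal)
    (hM : lengthAt R M 𝔮 = lengthAt R M 𝔮')
    (hP : lengthAt R (LinearMap.ker (c - LinearMap.id)) 𝔮 = lengthAt R (LinearMap.ker (c - LinearMap.id)) 𝔮')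
    (hfin : lengthAt R (LinearMap.ker (c - LinearMap.id)) 𝔮' ≠ ⊤) :
    lengthAt R (LinearMap.ker (c + LinearMap.id)) 𝔮 = lengthAt R (LinearMap.ker (c + LinearMap.id)) 𝔮' := by
  have h := lengthAt_eq_add_of_involution c hc 𝔮 h2
  have h' := lengthAt_eq_add_of_involution c hc 𝔮' h2'
  rw [hM, h', hP] at h
  exact ((add_right_inj_of_ne_top hfin).mp h).symm

end Involution

end Module

namespace Kato2004

open Literature.NumberTheory.EllipticCurves.IwasawaAlgebra Literature.NumberTheory.EllipticCurves.Module

variable {p : ℕ} [Fact p.Prime] {M : Type*} [AddCommGroup M] [Module (IwasawaAlgebra p) M]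

/-- **`ι`-symmetry of the minus part from that of the whole and of the plus part** (over `Λ = ℤ_p⟦T⟧`, at a
height-one `𝔮 ∌ 2` and its conjugate `ι𝔮 = PrimeSpectrum.comap (invol p) 𝔮`): for a `Λ`-linear involution `c` of
`M`, if `ℓ_𝔮(M) = ℓ_{ι𝔮}(M)` and `ℓ_𝔮(M⁺) = ℓ_{ι𝔮}(M⁺) < ∞` then `ℓ_𝔮(M⁻) = ℓ_{ι𝔮}(M⁻)`. With `M` the dual
Selmer group of the twist over `ℚ(ζ_{2^∞})` (symmetric by Greenberg's Thm. 1.14 over `ℚ(i)`, read prime by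
prime by `lengthAt_eq_comap_invol_of_map_invol_charIdeal_eq`) and `M⁺` that over `ℚ_∞` (Thm. 1.14 over `ℚ`),
this is the symmetry of `M⁻ ≐ X(E/ℚ_∞)` used by `lengthAt_H2_le_of_transport_exceptional`.
[cite: GreenbergLNM1716, Thm. 1.14 (p. 68) and §1 (p. 60)] -/
theorem lengthAt_minus_eq_comap_invol_of_total_of_plus (c : M →ₗ[IwasawaAlgebra p] M)
    (hc : ∀ m, c (c m) = m) (𝔮 : PrimeSpectrum (IwasawaAlgebra p))
    (h2 : (2 : IwasawaAlgebra p) ∉ 𝔮.asIdeal)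
    (hM : lengthAt (IwasawaAlgebra p) M 𝔮 =
      lengthAt (IwasawaAlgebra p) M (PrimeSpectrum.comap (invol p).toRingHom 𝔮))
    (hP : lengthAt (IwasawaAlgebra p) (LinearMap.ker (c - LinearMap.id)) 𝔮 =
      lengthAt (IwasawaAlgebra p) (LinearMap.ker (c - LinearMap.id))
        (PrimeSpectrum.comap (invol p).toRingHom 𝔮))
    (hfin : lengthAt (IwasawaAlgebra p) (LinearMap.ker (c - LinearMap.id))
      (PrimeSpectrum.comap (invol p).toRingHom 𝔮) ≠ ⊤) :
    lengthAt (IwasawaAlgebra p) (LinearMap.ker (c + LinearMap.id)) 𝔮 =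
      lengthAt (IwasawaAlgebra p) (LinearMap.ker (c + LinearMap.id))
        (PrimeSpectrum.comap (invol p).toRingHom 𝔮) := by
  refine lengthAt_minus_eq_of_total_of_plus c hc 𝔮 _ h2 ?_ hM hP hfin
  intro h
  apply h2
  rw [PrimeSpectrum.comap_asIdeal, Ideal.mem_comap] at h
  change invol p 2 ∈ 𝔮.asIdeal at h
  rwa [map_ofNat] at h

end Kato2004

end Literature.NumberTheory.EllipticCurves

end
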